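import Summits.QuantumFields.YangMills.Theorems.UnitScaleTiltProp7QprimeCombBumpSection
import Summits.QuantumFields.YangMills.Theorems.UnitScaleTiltProp7RieszTauFrobNormT3
import Summits.QuantumFields.YangMills.Theorems.UnitScaleTiltProp7DeltaEtaAlmostPositive
import Literature.MathematicalPhysics.QuantumFieldTheory.Balaban1983to89.B8Eq143PlaqExpansion
import HarnessLib

/-!
# Route `UnitScaleTilt`, crux K1 «MinimiserStabilityRegPr» (stmt-QuantumFields-19200) — route-R E′ (A′), LANE II «DIVERGENCE RECOVERY AT CURVED `W`» (★★OWNER RULING №23),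
# brick (B2a), FILE F2b: **THE SIZE AND GRADIENT ROWS OF A BUMP SECTION OF `QprimeCombL2 W` AT A THIN FRAME** — for the section of ✓`Prop7QprimeCombBumpSection.exists_bumpSection`
# (`l(transl x₀ z) = β(z)·Ad(σ z)⁻¹ u(y(z))`) with `|β| ≤ B`, in-box increments `|β(z + e_μ) − β(z)| ≤ B′η`, `β = 0` at both ends of every box-crossing bond, a `U1`-valued frame `σ`
# whose GAUGED BOND VARIABLES are thin (`‖σ(z)·W♯(z,μ)·σ(z+e_μ)⁻¹ − 1‖ ≤ ϑη` on in-box bonds — the one-shot axial frame of NAMER WORD №6 has this by lit `axial_bond_bound_sharp`):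
# `‖toL2S l‖² ≤ 2B²·c₀ℓ³Σ_y‖u y‖²` and `‖DL2 W (toL2S l)‖² ≤ 6(B′ + 2Bϑ)²·c₀ℓ³Σ_y‖u y‖²` — FIRST-ORDER rows with ABSOLUTE constants (the crude gradient bound `κ` that (B13)
# ✓`Prop7ResolventSmoothedPairing` and the SIGNATURE-0 (B2a) size row consume); plus the box-counting dictionary `Σ_{x : T⁽⁰⁾} g(box x) = ℓ³·Σ_{y : T⁽ᵏ⁾} g y`.

Cell `ym3-torus` ∕ fleet seat `ym-ust-19200-p1` (gen 19, LANE II namer; (B2a) pen).  THEOREMS ONLY (0 `def`, 0 `sorry`); `--supports stmt-QuantumFields-19200 --as helper`, count-neutral.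
YM₃ on T³ is a ladder rung (R3), not d = 4, not the Clay problem; nothing here claims [Balaban1985BackgroundPropagators] Thm 3.11, `hN06`, (REC), E′, EX or the gap.

WHAT IS PROVED (ns `…Theorems.Prop7QprimeCombBumpSectionRows`; member `F`, `n ≤ K`, `k = K − n`, `ℓ = Lᵏ`, `η = eta F n K = ℓ⁻¹`, `x₀ = basePt F n K`, `W♯ = pull (bgUnits F K W) x₀`,
`y(z) = tcls N_k (⌊z⌋^[k])`):
* §1 (matrices; lit ✓`B8Eq143PlaqExpansion.norm_conjR_sub_self_le` by name) ★ `norm_bond_term_le` — the covariant difference of the section across ONE bond in closed form: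
  `‖Ad(W_b)(β′·Ad(σ′)⁻¹u) − β·Ad(σ)⁻¹u‖ ≤ (|β′ − β| + 2|β|·‖σW_bσ′⁻¹ − 1‖)·‖u‖`.
* §2 (counting) `iterate_blockMap_mem_box_iff` (`z ∈ [0, ℓN)ᵈ ↔ ⌊z⌋^[k] ∈ [0, N)ᵈ`), ★ `sum_box_comp_iterate_blockMap` (`Σ_{z ∈ [0,ℓN)ᵈ} g(⌊z⌋^[k]) = ℓᵈ·Σ_{Y ∈ [0,N)ᵈ} g Y`),
  `transl_tlift_sub`, `transl_zero_eq_tcls`, ★★ `sum_site_comp_boxOf` (member: `Σ_{x : Site (F.P K) 0} g(y(tlift(x − x₀))) = ℓ³·Σ_{y : Site (F.P K) k} g y`).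
* §3 ★★ `norm_sq_toL2S_section_le` (SIZE) and ★★★ `norm_sq_DL2_section_le` (GRADIENT) for every `l` with the pointwise description, under the displayed profile∕frame rows.
HONEST SCOPE.  Lattice bookkeeping + 2×2 matrix inequalities; the thin-frame row `ϑ` and the profile rows are HYPOTHESES (inhabited in F5 by the axial frame ∕ a tensor tent); no estimate of
print; rung R3, not Clay; YM gap NOT proved.

References: T. Bałaban, CMP 99 (1985) 389–434 [Balaban1985BackgroundPropagators] ((3.3) p.391, (3.17)–(3.19) p.393); CMP 99 (1985) 75–102 [Balaban1985RegularSpaces] (Lemma 1 (1.25) p.79);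
CMP 98 (1985) 17–51 [Balaban1985Averaging] ((42)–(44) p.24).
-/

set_option autoImplicit false

noncomputable section

open scoped InnerProductSpace Matrix.Norms.L2Operator BigOperators

namespace Summit.QuantumFields.YangMills.Theorems.Prop7QprimeCombBumpSectionRows

open Literature.MathematicalPhysics.QuantumFieldTheory.Balaban1983to89
open Literature.MathematicalPhysics.QuantumFieldTheory.Balaban1983to89.T3ContinuumYM3Torus
open Literature.MathematicalPhysics.QuantumLattice (blockMap blockBase blockSites mem_blockSites_iff)
open B7Prop1Explicit renaming Site → LSite
open B7Prop1Explicit (U1 e e_apply)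
open B7Eq78Linearization (conjR conjR_apply conjR_smul_real)
open B7Prop3GeneralRotated (conjR_mul_left)
open B8Ineq132 (norm_conjR)
open B8Eq143PlaqExpansion (norm_conjR_sub_self_le)
open B9B8AveragingKernelZd (blockIter mem_blockIter_iff card_blockIter)
open B10Eq27TorusAxialLog (transl transl_apply pull)
open B10StarCount (sum_pbond)
open T4TermwiseTorus (IsPeriodic tcls tlift tcls_tlift tcls_apply box mem_box tlift_mem_box tlift_tcls_of_mem_box)
open T3SectALandauChart (bgUnits eta eta_pos)
open B11Eq103H1Complex (SiteL2K BondL2K)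
open Summit.QuantumFields.YangMills.Theorems.Prop7SectET3Transport (periodsT3 bondEquiv bgOfCfg val_bgOfCfg)
open Summit.QuantumFields.YangMills.Theorems.Prop7SectET3HilbertLetters (W₂ frobEquiv toL2 toL2S DL2 DL2_apply toL2S_symm_apply)
open Summit.QuantumFields.YangMills.Theorems.Prop7SPrint (basePt)
open Summit.QuantumFields.YangMills.Theorems.Prop7QprimeCombL2 (sitesPerDir_zero_eq)
open Summit.QuantumFields.YangMills.Theorems.Prop7LandauCombDict (sum_univ_eq_sum_box_transl)
open Summit.QuantumFields.YangMills.Theorems.Prop7RieszTauFrobNorm (norm_frobEquiv_symm_le)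
open Summit.QuantumFields.YangMills.Theorems.Prop7DeltaEtaAlmostPositive (norm_toL2_sq)

/-! ## §1 Two matrix inequalities -/

section Matrices

variable {𝔸 : Type*} [NormedRing 𝔸] [NormOneClass 𝔸] [NormedAlgebra ℂ 𝔸]

/-- ★ **THE SECTION ACROSS ONE BOND, CLOSED FORM AND BOUND**: with `g := σ·W_b·σ′⁻¹` (the frame-gauged bond variable),
`Ad(W_b)(β′·Ad(σ′)⁻¹u) − β·Ad(σ)⁻¹u = Ad(σ)⁻¹((β′ − β)·Ad(g)u + β·(Ad(g)u − u))`, hence `≤ (|β′ − β| + 2|β|‖g − 1‖)·‖u‖` for `σ, σ′, W_b ∈ U1`.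
[cite: Balaban1985BackgroundPropagators, (3.3) p.391; Balaban1985RegularSpaces, (1.25) p.79] -/
theorem norm_bond_term_le {σ σ' Wb : 𝔸ˣ} (hσ : σ ∈ U1 𝔸) (hσ' : σ' ∈ U1 𝔸) (hWb : Wb ∈ U1 𝔸) (β β' : ℝ) (u : 𝔸) :
    ‖conjR Wb (β' • conjR σ'⁻¹ u) - β • conjR σ⁻¹ u‖ ≤ (|β' - β| + 2 * |β| * ‖((σ * Wb * σ'⁻¹ : 𝔸ˣ) : 𝔸) - 1‖) * ‖u‖ := by
  set g : 𝔸ˣ := σ * Wb * σ'⁻¹ with hg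
  have hgU : g ∈ U1 𝔸 := Subgroup.mul_mem _ (Subgroup.mul_mem _ hσ hWb) (Subgroup.inv_mem _ hσ')
  have hσinv : σ⁻¹ ∈ U1 𝔸 := Subgroup.inv_mem _ hσ
  have hkey : Wb * σ'⁻¹ = σ⁻¹ * g := by rw [hg]; group
  have hid : conjR Wb (β' • conjR σ'⁻¹ u) - β • conjR σ⁻¹ u = conjR σ⁻¹ ((β' - β) • conjR g u + β • (conjR g u - u)) := by
    rw [conjR_smul_real, ← conjR_mul_left, hkey, conjR_mul_left]
    have hrhs : (β' - β) • conjR g u + β • (conjR g u - u) = β' • conjR g u - β • u := by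
      rw [sub_smul, smul_sub]; abel
    rw [hrhs, B7Eq78Linearization.conjR_sub, conjR_smul_real, conjR_smul_real]
  rw [hid, norm_conjR hσinv]
  calc ‖(β' - β) • conjR g u + β • (conjR g u - u)‖ ≤ ‖(β' - β) • conjR g u‖ + ‖β • (conjR g u - u)‖ := norm_add_le _ _
    _ = |β' - β| * ‖u‖ + |β| * ‖conjR g u - u‖ := by rw [norm_smul, norm_smul, Real.norm_eq_abs, Real.norm_eq_abs, norm_conjR hgU]
    _ ≤ |β' - β| * ‖u‖ + |β| * (2 * ‖(g : 𝔸) - 1‖ * ‖u‖) := by gcongr; exact norm_conjR_sub_self_le hgU u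
    _ = (|β' - β| + 2 * |β| * ‖(g : 𝔸) - 1‖) * ‖u‖ := by ring

end Matrices

/-! ## §2 Counting: boxes of `ℤᵈ` and the member's sites -/

section Counting

variable {d : ℕ}

/-- `z ∈ [0, LᵏN)ᵈ ↔ ⌊z⌋^[k] ∈ [0, N)ᵈ`. [folklore; cite: Balaban1985RegularSpaces, p.77] -/
theorem iterate_blockMap_mem_box_iff (L : ℕ) [NeZero L] : ∀ (k N : ℕ) (z : LSite d), z ∈ box (L ^ k * N) ↔ (blockMap L)^[k] z ∈ box N
  | 0, N, z => by simp
  | k + 1, N, z => by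
      have hL : (0 : ℤ) < (L : ℤ) := by exact_mod_cast Nat.pos_of_ne_zero (NeZero.ne L)
      rw [Function.iterate_succ_apply, ← iterate_blockMap_mem_box_iff L k N (blockMap L z), mem_box, mem_box]
      refine forall_congr' fun κ => ?_
      simp only [blockMap, Nat.cast_pow, Nat.cast_mul]
      rw [show ((L : ℤ) ^ (k + 1) * (N : ℤ)) = (L : ℤ) * ((L : ℤ) ^ k * (N : ℤ)) by ring]
      constructor
      · rintro ⟨h0, h1⟩
        exact ⟨Int.ediv_nonneg h0 hL.le, Int.ediv_lt_of_lt_mul hL (by linarith [mul_comm (L : ℤ) ((L : ℤ) ^ k * (N : ℤ))])⟩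
      · rintro ⟨h0, h1⟩
        constructor
        · by_contra hneg
          have hneg' : z κ < 0 := lt_of_not_ge hneg
          have : z κ / (L : ℤ) < 0 := Int.ediv_neg_of_neg_of_pos hneg' hL
          omega
        · have h2 : z κ / (L : ℤ) + 1 ≤ (L : ℤ) ^ k * (N : ℤ) := h1
          have h3 : z κ < (z κ / (L : ℤ) + 1) * (L : ℤ) := Int.lt_ediv_add_one_mul_self _ hL
          nlinarith

/-- ★ **`Σ_{z ∈ [0,LᵏN)ᵈ} g(⌊z⌋^[k]) = (Lᵈ)ᵏ·Σ_{Y ∈ [0,N)ᵈ} g Y`** — every coarse site has exactly `(Lᵈ)ᵏ` fine sites in its box. [cite: Balaban1985Averaging, (78) p.30 («L^d sites»)] -/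
theorem sum_box_comp_iterate_blockMap {M : Type*} [AddCommMonoid M] (L : ℕ) [NeZero L] (k N : ℕ) (g : LSite d → M) :
    ∑ z ∈ box (d := d) (L ^ k * N), g ((blockMap L)^[k] z) = ((L ^ d) ^ k) • ∑ Y ∈ box (d := d) N, g Y := by
  classical
  have hfib : ∀ Y ∈ box (d := d) N, (box (d := d) (L ^ k * N)).filter (fun z => (blockMap L)^[k] z = Y) = blockIter L k Y := by
    intro Y hY
    ext z
    rw [Finset.mem_filter, mem_blockIter_iff]
    constructor
    · exact fun h => h.2
    · intro h
      exact ⟨(iterate_blockMap_mem_box_iff L k N z).2 (h ▸ hY), h⟩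
  rw [← Finset.sum_fiberwise_of_maps_to (g := fun z => (blockMap L)^[k] z) (t := box (d := d) N)
      (fun z hz => (iterate_blockMap_mem_box_iff L k N z).1 hz)]
  rw [Finset.smul_sum]
  refine Finset.sum_congr rfl fun Y hY => ?_
  rw [Finset.sum_congr rfl (fun z hz => by rw [(Finset.mem_filter.1 hz).2]), Finset.sum_const, hfib Y hY, card_blockIter]

variable {P : Params} {j : ℕ}

/-- `transl y (tlift (x − y)) = x`. [folklore; cite: Balaban1985RegularSpaces, (1.3) p.77] -/
theorem transl_tlift_sub (y x : Site P j) : transl y (tlift (fun κ => x κ - y κ)) = x := by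
  funext ν
  have h := congrFun (tcls_tlift (T := P.sitesPerDir j) (fun κ => x κ - y κ)) ν
  rw [tcls_apply] at h
  show y ν + (((tlift fun κ => x κ - y κ) ν : ℤ) : ZMod (P.sitesPerDir j)) = x ν
  rw [h]; abel

/-- `transl 0 z = tcls z`. [folklore; cite: Balaban1985RegularSpaces, (1.3) p.77] -/
theorem transl_zero_eq_tcls (z : LSite P.d) : transl (0 : Site P j) z = tcls (P.sitesPerDir j) z := by
  funext ν
  rw [transl_apply, tcls_apply]
  exact zero_add _

end Counting

/-! ## §3 The rows at the member -/

section Member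

variable (F : T3Family) (n K : ℕ) (c₀ : ℝ) [Fact (0 < c₀)]

/-- ★★ **BOX COUNTING ON THE MEMBER**: `Σ_{x : T⁽⁰⁾} g(y(x)) = ℓ³·Σ_{y : T⁽ᵏ⁾} g y`, `y(x) = tcls N_k (⌊tlift(x − x₀)⌋^[k])` the comb box of `x`.
[cite: Balaban1985Averaging, (78) p.30; Balaban1985RegularSpaces, p.77] -/
theorem sum_site_comp_boxOf {M : Type*} [AddCommMonoid M] (hnK : n ≤ K) (g : Site (F.P K) (K - n) → M) :
    ∑ x : Site (F.P K) 0, g (tcls ((F.P K).sitesPerDir (K - n)) ((blockMap (F.P K).L)^[K - n] (tlift (fun κ => x κ - basePt F n K κ))))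
      = (((F.P K).L ^ (F.P K).d) ^ (K - n)) • ∑ y : Site (F.P K) (K - n), g y := by
  haveI : NeZero (F.P K).L := ⟨by have h := F.hL.2; show F.L ≠ 0; omega⟩
  rw [sum_univ_eq_sum_box_transl (basePt F n K)]
  have h1 : ∀ z ∈ box (d := (F.P K).d) ((F.P K).sitesPerDir 0),
      g (tcls ((F.P K).sitesPerDir (K - n)) ((blockMap (F.P K).L)^[K - n] (tlift (fun κ => transl (basePt F n K) z κ - basePt F n K κ))))
        = g (tcls ((F.P K).sitesPerDir (K - n)) ((blockMap (F.P K).L)^[K - n] z)) := by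
    intro z hz
    have h : (fun κ => transl (basePt F n K) z κ - basePt F n K κ) = tcls ((F.P K).sitesPerDir 0) z := by
      funext κ; simp [transl, tcls_apply]
    rw [h, tlift_tcls_of_mem_box hz]
  rw [Finset.sum_congr rfl h1, sitesPerDir_zero_eq F n K hnK,
    sum_box_comp_iterate_blockMap (F.P K).L (K - n) ((F.P K).sitesPerDir (K - n)) (fun Y => g (tcls ((F.P K).sitesPerDir (K - n)) Y)),
    sum_univ_eq_sum_box_transl (0 : Site (F.P K) (K - n))]
  refine congrArg _ (Finset.sum_congr rfl fun Y _ => ?_)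
  rw [transl_zero_eq_tcls]

variable {F n K c₀}

/-- ★★ **THE SIZE ROW**: for `l` with `l(transl x₀ z) = β(z)·Ad(σ z)⁻¹ u(y(z))`, `|β| ≤ B`, `σ ∈ U1`: `‖toL2S l‖² ≤ 2B²·c₀ℓ³·Σ_y‖u y‖²` (Frobenius vs operator norm costs the `2`).
[cite: Balaban1985BackgroundPropagators, (3.11) p.392, (3.19) p.393] -/
theorem norm_sq_toL2S_section_le (hnK : n ≤ K) (σ : LSite (F.P K).d → (Matrix (Fin 2) (Fin 2) ℂ)ˣ) (hσ : ∀ z, σ z ∈ U1 (Matrix (Fin 2) (Fin 2) ℂ))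
    (β : LSite (F.P K).d → ℝ) {B : ℝ} (hB : ∀ z, |β z| ≤ B)
    (u : Site (F.P K) (K - n) → Matrix (Fin 2) (Fin 2) ℂ) (l : Site (F.P K) 0 → Matrix (Fin 2) (Fin 2) ℂ)
    (hl : ∀ z : LSite (F.P K).d, l (transl (basePt F n K) z)
      = β z • conjR (σ z)⁻¹ (u (tcls ((F.P K).sitesPerDir (K - n)) ((blockMap (F.P K).L)^[K - n] z)))) :
    ‖toL2S F K c₀ l‖ ^ 2 ≤ 2 * B ^ 2 * (c₀ * ((F.L : ℝ) ^ (K - n)) ^ 3 * ∑ y : Site (F.P K) (K - n), ‖u y‖ ^ 2) := by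
  have hc₀ : 0 < c₀ := Fact.out
  have hB0 : 0 ≤ B := (abs_nonneg _).trans (hB 0)
  -- `‖toL2S l‖² = c₀ Σ_x ‖frobEquiv⁻¹(l x)‖²`
  have hnorm : ‖toL2S F K c₀ l‖ ^ 2 = c₀ * ∑ x : Site (F.P K) 0, ‖(frobEquiv.symm (l x) : W₂)‖ ^ 2 := by
    have h := Summit.QuantumFields.YangMills.Theorems.Prop7SectET3RealCoordSums.inner_toL2S (F := F) (K := K) (c₀ := c₀) l l
    rw [← inner_self_eq_norm_sq (𝕜 := ℂ), h]
    simp only [RCLike.re_to_complex, Complex.re_ofReal_mul]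
    congr 1
    rw [Complex.re_sum]
    refine Finset.sum_congr rfl fun x _ => ?_
    rw [← Summit.QuantumFields.YangMills.Theorems.Prop7SectET3HilbertLetters.inner_frobEquiv_symm, ← inner_self_eq_norm_sq (𝕜 := ℂ)]
    rfl
  -- pointwise: `‖frobEquiv⁻¹(l x)‖² ≤ 2B²‖u(y(x))‖²`
  have hpt : ∀ x : Site (F.P K) 0, ‖(frobEquiv.symm (l x) : W₂)‖ ^ 2
      ≤ 2 * B ^ 2 * ‖u (tcls ((F.P K).sitesPerDir (K - n)) ((blockMap (F.P K).L)^[K - n] (tlift (fun κ => x κ - basePt F n K κ))))‖ ^ 2 := by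
    intro x
    set z := tlift (fun κ => x κ - basePt F n K κ) with hz
    have hx : x = transl (basePt F n K) z := (transl_tlift_sub (basePt F n K) x).symm
    have h1 : ‖(frobEquiv.symm (l x) : W₂)‖ ≤ Real.sqrt 2 * ‖l x‖ := norm_frobEquiv_symm_le _
    have h2 : ‖l x‖ ≤ B * ‖u (tcls ((F.P K).sitesPerDir (K - n)) ((blockMap (F.P K).L)^[K - n] z))‖ := by
      rw [hx, hl z, norm_smul, Real.norm_eq_abs, norm_conjR (Subgroup.inv_mem _ (hσ z))]
      exact mul_le_mul_of_nonneg_right (hB z) (norm_nonneg _)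
    have h3 : ‖(frobEquiv.symm (l x) : W₂)‖ ≤ Real.sqrt 2 * (B * ‖u (tcls ((F.P K).sitesPerDir (K - n)) ((blockMap (F.P K).L)^[K - n] z))‖) :=
      h1.trans (mul_le_mul_of_nonneg_left h2 (Real.sqrt_nonneg _))
    calc ‖(frobEquiv.symm (l x) : W₂)‖ ^ 2 ≤ (Real.sqrt 2 * (B * ‖u (tcls ((F.P K).sitesPerDir (K - n)) ((blockMap (F.P K).L)^[K - n] z))‖)) ^ 2 :=
          pow_le_pow_left₀ (norm_nonneg _) h3 2
      _ = 2 * B ^ 2 * ‖u (tcls ((F.P K).sitesPerDir (K - n)) ((blockMap (F.P K).L)^[K - n] z))‖ ^ 2 := by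
          rw [mul_pow, mul_pow, Real.sq_sqrt (by norm_num)]; ring
  rw [hnorm]
  have hsum := Finset.sum_le_sum fun x (_ : x ∈ Finset.univ) => hpt x
  rw [← Finset.mul_sum, sum_site_comp_boxOf F n K hnK (fun y => ‖u y‖ ^ 2)] at hsum
  have hLd : ((((F.P K).L ^ (F.P K).d) ^ (K - n) : ℕ) : ℝ) = ((F.L : ℝ) ^ (K - n)) ^ 3 := by
    rw [show (F.P K).d = 3 from T3Family.P_d F K, show (F.P K).L = F.L from rfl]; push_cast; ring
  rw [nsmul_eq_mul, hLd] at hsum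
  calc c₀ * ∑ x : Site (F.P K) 0, ‖(frobEquiv.symm (l x) : W₂)‖ ^ 2 ≤ c₀ * (2 * B ^ 2 * (((F.L : ℝ) ^ (K - n)) ^ 3 * ∑ y, ‖u y‖ ^ 2)) :=
        mul_le_mul_of_nonneg_left hsum hc₀.le
    _ = 2 * B ^ 2 * (c₀ * ((F.L : ℝ) ^ (K - n)) ^ 3 * ∑ y : Site (F.P K) (K - n), ‖u y‖ ^ 2) := by ring

/-- `(transl y z).shift μ = transl y (z + e_μ)`. [folklore; cite: Balaban1985RegularSpaces, (1.3) p.77] -/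
theorem shift_transl_eq {P : Params} {j : ℕ} (y : Site P j) (z : LSite P.d) (μ : Fin P.d) : (transl y z).shift μ = transl y (z + e μ) := by
  funext ν
  simp only [Site.shift, transl_apply, Pi.add_apply, e_apply]
  by_cases hν : ν = μ
  · subst hν; simp only [Function.update_self, if_true]; push_cast; ring
  · rw [Function.update_of_ne hν, transl_apply, if_neg hν, add_zero]

/-- The pulled-back background letter is the member's bond variable read in `M₂`: `↑(W♯(z, μ)) = ↑(W⟨transl x₀ z, μ⟩)`. [cite: Balaban1985Averaging, (19) p.21] -/
theorem val_pull_bgUnits (W : GaugeField (F.P K) 0 (Matrix.specialUnitaryGroup (Fin 2) ℂ)) (x₀ : Site (F.P K) 0) (z : LSite (F.P K).d) (μ : Fin (F.P K).d) :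
    ((pull (bgUnits F K W) x₀ z μ : (Matrix (Fin 2) (Fin 2) ℂ)ˣ) : Matrix (Fin 2) (Fin 2) ℂ)
      = ((W ⟨transl x₀ z, μ⟩ : Matrix.specialUnitaryGroup (Fin 2) ℂ) : Matrix (Fin 2) (Fin 2) ℂ) := rfl

/-- The pulled-back background is `U1`-valued. [cite: Balaban1985Averaging, (19) p.21] -/
theorem pull_bgUnits_mem_U1 (W : GaugeField (F.P K) 0 (Matrix.specialUnitaryGroup (Fin 2) ℂ)) (x₀ : Site (F.P K) 0) (z : LSite (F.P K).d) (μ : Fin (F.P K).d) :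
    pull (bgUnits F K W) x₀ z μ ∈ U1 (Matrix (Fin 2) (Fin 2) ℂ) := by
  letI : CStarAlgebra (Matrix (Fin 2) (Fin 2) ℂ) := B10Eq29TubeLine.cstarAlgebraMatrix 2
  exact B7Prop2Explicit.unitaryUnits_le_U1 (B10Eq27TorusAxialLog.unitsField_mem_unitaryUnits (B10Eq27TorusAxialLog.toUField W) _)

/-- ★★★ **THE GRADIENT ROW** (crude, FIRST ORDER): for `l` with `l(transl x₀ z) = β(z)·Ad(σ z)⁻¹ u(y(z))`, `σ ∈ U1`, `|β| ≤ B`, in-box profile increments `|β(z+e_μ) − β(z)| ≤ B′η`,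
`β = 0` at both ends of every box-crossing bond, and the THIN-FRAME row `‖σ(z)·W♯(z,μ)·σ(z+e_μ)⁻¹ − 1‖ ≤ ϑη` on in-box bonds:
`‖DL2 W (toL2S l)‖² ≤ 6·(B′ + 2Bϑ)²·c₀ℓ³·Σ_y‖u y‖²` — the `η⁻¹` of (3.3) is paid by the profile's `η`-increments and the frame's `η`-thinness; ABSOLUTE constant.
[cite: Balaban1985BackgroundPropagators, (3.3) p.391, (3.19) p.393; Balaban1985RegularSpaces, Lemma 1 (1.25) p.79] -/
theorem norm_sq_DL2_section_le (hnK : n ≤ K) (W : GaugeField (F.P K) 0 (Matrix.specialUnitaryGroup (Fin 2) ℂ))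
    (σ : LSite (F.P K).d → (Matrix (Fin 2) (Fin 2) ℂ)ˣ) (hσ : ∀ z, σ z ∈ U1 (Matrix (Fin 2) (Fin 2) ℂ))
    (β : LSite (F.P K).d → ℝ) {B B' ϑ : ℝ} (hB0 : 0 ≤ B) (hB'0 : 0 ≤ B') (hϑ0 : 0 ≤ ϑ) (hB : ∀ z, |β z| ≤ B)
    (hβlip : ∀ (z : LSite (F.P K).d) (μ : Fin (F.P K).d), (blockMap (F.P K).L)^[K - n] (z + e μ) = (blockMap (F.P K).L)^[K - n] z →
      |β (z + e μ) - β z| ≤ B' * eta F n K)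
    (hβ0 : ∀ (z : LSite (F.P K).d) (μ : Fin (F.P K).d), (blockMap (F.P K).L)^[K - n] (z + e μ) ≠ (blockMap (F.P K).L)^[K - n] z →
      β z = 0 ∧ β (z + e μ) = 0)
    (hthin : ∀ (z : LSite (F.P K).d) (μ : Fin (F.P K).d), (blockMap (F.P K).L)^[K - n] (z + e μ) = (blockMap (F.P K).L)^[K - n] z →
      ‖((σ z * pull (bgUnits F K W) (basePt F n K) z μ * (σ (z + e μ))⁻¹ : (Matrix (Fin 2) (Fin 2) ℂ)ˣ) : Matrix (Fin 2) (Fin 2) ℂ) - 1‖ ≤ ϑ * eta F n K)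
    (u : Site (F.P K) (K - n) → Matrix (Fin 2) (Fin 2) ℂ) (l : Site (F.P K) 0 → Matrix (Fin 2) (Fin 2) ℂ)
    (hl : ∀ z : LSite (F.P K).d, l (transl (basePt F n K) z)
      = β z • conjR (σ z)⁻¹ (u (tcls ((F.P K).sitesPerDir (K - n)) ((blockMap (F.P K).L)^[K - n] z)))) :
    ‖DL2 F n K c₀ W (toL2S F K c₀ l)‖ ^ 2 ≤ 6 * (B' + 2 * B * ϑ) ^ 2 * (c₀ * ((F.L : ℝ) ^ (K - n)) ^ 3 * ∑ y : Site (F.P K) (K - n), ‖u y‖ ^ 2) := by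
  have hc₀ : 0 < c₀ := Fact.out
  have hη : 0 < eta F n K := eta_pos F n K
  set Nk := (F.P K).sitesPerDir (K - n) with hNk
  set X : PBond (F.P K) 0 → Matrix (Fin 2) (Fin 2) ℂ := (toL2 F K c₀).symm (DL2 F n K c₀ W (toL2S F K c₀ l)) with hX
  have hDX : DL2 F n K c₀ W (toL2S F K c₀ l) = toL2 F K c₀ X := by rw [hX, LinearEquiv.apply_symm_apply]
  -- the per-bond bound
  have hbond : ∀ (x : Site (F.P K) 0) (μ : Fin (F.P K).d),
      ‖X ⟨x, μ⟩‖ ≤ (B' + 2 * B * ϑ) * ‖u (tcls Nk ((blockMap (F.P K).L)^[K - n] (tlift (fun κ => x κ - basePt F n K κ))))‖ := by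
    intro x μ
    set z := tlift (fun κ => x κ - basePt F n K κ) with hz
    have hx : x = transl (basePt F n K) z := (transl_tlift_sub (basePt F n K) x).symm
    -- the bond variable as a unit and the two endpoint values
    set Wu : (Matrix (Fin 2) (Fin 2) ℂ)ˣ := pull (bgUnits F K W) (basePt F n K) z μ with hWu
    have hWuU : Wu ∈ U1 (Matrix (Fin 2) (Fin 2) ℂ) := pull_bgUnits_mem_U1 W _ z μ
    have htgt : (⟨x, μ⟩ : PBond (F.P K) 0).tgt = transl (basePt F n K) (z + e μ) := by
      show x.shift μ = _; rw [hx, shift_transl_eq]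
    have hunit : bgOfCfg F K W (bondEquiv F K ⟨x, μ⟩) = Wu := by
      apply Units.ext
      rw [val_bgOfCfg, Equiv.symm_apply_apply, hWu, val_pull_bgUnits, ← hx]
    have hXb : X ⟨x, μ⟩ = (((eta F n K : ℝ) : ℂ)⁻¹) • (conjR Wu (l (transl (basePt F n K) (z + e μ))) - l (transl (basePt F n K) z)) := by
      rw [hX, DL2_apply, conjR_apply, htgt, hunit, ← hx]
      congr 2
      rw [hWu, val_pull_bgUnits, ← hx]
    rw [hXb, hl (z + e μ), hl z, norm_smul, norm_inv, Complex.norm_real, Real.norm_of_nonneg hη.le]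
    by_cases hbox : (blockMap (F.P K).L)^[K - n] (z + e μ) = (blockMap (F.P K).L)^[K - n] z
    · rw [hbox]
      have hbt := norm_bond_term_le (hσ z) (hσ (z + e μ)) hWuU (β z) (β (z + e μ)) (u (tcls Nk ((blockMap (F.P K).L)^[K - n] z)))
      have hfac : |β (z + e μ) - β z| + 2 * |β z| * ‖((σ z * Wu * (σ (z + e μ))⁻¹ : (Matrix (Fin 2) (Fin 2) ℂ)ˣ) : Matrix (Fin 2) (Fin 2) ℂ) - 1‖
          ≤ (B' + 2 * B * ϑ) * eta F n K := by
        have h1 := hβlip z μ hbox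
        have h2 := hthin z μ hbox
        have h3 := hB z
        calc |β (z + e μ) - β z| + 2 * |β z| * ‖((σ z * Wu * (σ (z + e μ))⁻¹ : (Matrix (Fin 2) (Fin 2) ℂ)ˣ) : Matrix (Fin 2) (Fin 2) ℂ) - 1‖
            ≤ B' * eta F n K + 2 * B * (ϑ * eta F n K) := by
              gcongr
          _ = (B' + 2 * B * ϑ) * eta F n K := by ring
      calc (eta F n K)⁻¹ * ‖conjR Wu (β (z + e μ) • conjR (σ (z + e μ))⁻¹ (u (tcls Nk ((blockMap (F.P K).L)^[K - n] z))))
              - β z • conjR (σ z)⁻¹ (u (tcls Nk ((blockMap (F.P K).L)^[K - n] z)))‖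
          ≤ (eta F n K)⁻¹ * ((|β (z + e μ) - β z| + 2 * |β z| * ‖((σ z * Wu * (σ (z + e μ))⁻¹ : (Matrix (Fin 2) (Fin 2) ℂ)ˣ) : Matrix (Fin 2) (Fin 2) ℂ) - 1‖)
              * ‖u (tcls Nk ((blockMap (F.P K).L)^[K - n] z))‖) := mul_le_mul_of_nonneg_left hbt (inv_nonneg.mpr hη.le)
        _ ≤ (eta F n K)⁻¹ * (((B' + 2 * B * ϑ) * eta F n K) * ‖u (tcls Nk ((blockMap (F.P K).L)^[K - n] z))‖) := by gcongr
        _ = (B' + 2 * B * ϑ) * ‖u (tcls Nk ((blockMap (F.P K).L)^[K - n] z))‖ := by field_simp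
    · obtain ⟨h0, h1⟩ := hβ0 z μ hbox
      rw [h0, h1, zero_smul, zero_smul, conjR_apply, mul_zero, zero_mul, sub_zero, norm_zero, mul_zero]
      positivity
  -- Frobenius vs operator norm, sum over bonds, count the boxes
  rw [hDX, norm_toL2_sq, sum_pbond]
  have hpt : ∀ (x : Site (F.P K) 0) (μ : Fin (F.P K).d), ‖(frobEquiv.symm (X ⟨x, μ⟩) : W₂)‖ ^ 2
      ≤ 2 * (B' + 2 * B * ϑ) ^ 2 * ‖u (tcls Nk ((blockMap (F.P K).L)^[K - n] (tlift (fun κ => x κ - basePt F n K κ))))‖ ^ 2 := by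
    intro x μ
    have h1 : ‖(frobEquiv.symm (X ⟨x, μ⟩) : W₂)‖ ≤ Real.sqrt 2 * ‖X ⟨x, μ⟩‖ := norm_frobEquiv_symm_le _
    have h2 := h1.trans (mul_le_mul_of_nonneg_left (hbond x μ) (Real.sqrt_nonneg _))
    calc ‖(frobEquiv.symm (X ⟨x, μ⟩) : W₂)‖ ^ 2 ≤ (Real.sqrt 2 * ((B' + 2 * B * ϑ) * ‖u (tcls Nk ((blockMap (F.P K).L)^[K - n] (tlift (fun κ => x κ - basePt F n K κ))))‖)) ^ 2 :=
          pow_le_pow_left₀ (norm_nonneg _) h2 2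
      _ = 2 * (B' + 2 * B * ϑ) ^ 2 * ‖u (tcls Nk ((blockMap (F.P K).L)^[K - n] (tlift (fun κ => x κ - basePt F n K κ))))‖ ^ 2 := by
          rw [mul_pow, mul_pow, Real.sq_sqrt (by norm_num)]; ring
  have hd : (F.P K).d = 3 := T3Family.P_d F K
  have hsite : ∀ x : Site (F.P K) 0, ∑ μ : Fin (F.P K).d, ‖(frobEquiv.symm (X ⟨x, μ⟩) : W₂)‖ ^ 2
      ≤ 6 * (B' + 2 * B * ϑ) ^ 2 * ‖u (tcls Nk ((blockMap (F.P K).L)^[K - n] (tlift (fun κ => x κ - basePt F n K κ))))‖ ^ 2 := by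
    intro x
    calc ∑ μ : Fin (F.P K).d, ‖(frobEquiv.symm (X ⟨x, μ⟩) : W₂)‖ ^ 2
        ≤ ∑ _μ : Fin (F.P K).d, 2 * (B' + 2 * B * ϑ) ^ 2 * ‖u (tcls Nk ((blockMap (F.P K).L)^[K - n] (tlift (fun κ => x κ - basePt F n K κ))))‖ ^ 2 :=
          Finset.sum_le_sum fun μ _ => hpt x μ
      _ = 6 * (B' + 2 * B * ϑ) ^ 2 * ‖u (tcls Nk ((blockMap (F.P K).L)^[K - n] (tlift (fun κ => x κ - basePt F n K κ))))‖ ^ 2 := by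
          rw [Finset.sum_const, Finset.card_univ, Fintype.card_fin, nsmul_eq_mul]
          have hd3 : (((F.P K).d : ℕ) : ℝ) = 3 := by exact_mod_cast hd
          rw [hd3]; ring
  have hsum := Finset.sum_le_sum fun x (_ : x ∈ Finset.univ) => hsite x
  rw [← Finset.mul_sum, sum_site_comp_boxOf F n K hnK (fun y => ‖u y‖ ^ 2)] at hsum
  have hLd : ((((F.P K).L ^ (F.P K).d) ^ (K - n) : ℕ) : ℝ) = ((F.L : ℝ) ^ (K - n)) ^ 3 := by
    rw [hd, show (F.P K).L = F.L from rfl]; push_cast; ring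
  rw [nsmul_eq_mul, hLd] at hsum
  calc c₀ * ∑ x : Site (F.P K) 0, ∑ μ : Fin (F.P K).d, ‖(frobEquiv.symm (X ⟨x, μ⟩) : W₂)‖ ^ 2
      ≤ c₀ * (6 * (B' + 2 * B * ϑ) ^ 2 * (((F.L : ℝ) ^ (K - n)) ^ 3 * ∑ y, ‖u y‖ ^ 2)) := mul_le_mul_of_nonneg_left hsum hc₀.le
    _ = 6 * (B' + 2 * B * ϑ) ^ 2 * (c₀ * ((F.L : ℝ) ^ (K - n)) ^ 3 * ∑ y : Site (F.P K) (K - n), ‖u y‖ ^ 2) := by ring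

end Member

end Summit.QuantumFields.YangMills.Theorems.Prop7QprimeCombBumpSectionRows

end
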